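import Mathlib
import HarnessLib
import Summits.ValiantsHypothesis.ValiantsHypothesis.Theses.MonotoneRestoration
import Literature.Computability.AlgebraicComplexity.ArithCircuit
import Literature.Computability.AlgebraicComplexity.ArithCircuitProofs
import Literature.Computability.AlgebraicComplexity.MonotoneStructure
import Literature.Computability.AlgebraicComplexity.PermanentIrreducible
import Literature.ModelTheory.FiniteModelTheory.CkEquiv
import Summits.ValiantsHypothesis.ValiantsHypothesis.Theorems.MonotoneRestorationMonotoneRestorationQPCosetCount
import Summits.ValiantsHypothesis.ValiantsHypothesis.Theorems.MonotoneRestorationMonotoneRestorationQPSymmetricLB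
import Summits.ValiantsHypothesis.ValiantsHypothesis.Theorems.MonotoneRestorationMonotoneRestorationQPSupportSymmetrisation
import Summits.ValiantsHypothesis.ValiantsHypothesis.Theorems.MonotoneRestorationMonotoneRestorationQPSparseRegime
import Summits.ValiantsHypothesis.ValiantsHypothesis.Theorems.MonotoneRestorationMonotoneRestorationQPBeta
import Literature.Computability.AlgebraicComplexity.SymmetricArithCircuit
import Literature.Computability.AlgebraicComplexity.DawarWilsenach2025Proofs
import Literature.GroupTheory.PermutationGroups.SmallIndexSubgroups
import Summits.ValiantsHypothesis.ValiantsHypothesis.Theorems.MonotoneRestorationQP.Negative.LoadBearing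
import Summits.ValiantsHypothesis.ValiantsHypothesis.Theorems.MonotoneRestorationMonotoneRestorationQPPermSupportCount

/-! TTRL-lite variant V21337 of stmt-ValiantsHypothesis-15886

Target `stub_symmetricMonotone` neighbourhood (move `lemma_proposal`): symmetry of a labelled
arithmetic circuit under `Sym_n` only needs to be checked on TRANSPOSITIONS — if every `swap i j`
(`i ≠ j`) extends to a circuit automorphism then `C` is `Sym_n`-symmetric.

Proof: the permutations admitting an extension are closed under `1` and products
(`isAutomorphismExtending_one`, `IsAutomorphismExtending.trans`), and transpositions generate
`Sym_n` (`Equiv.Perm.swap_induction_on`).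
-/

-- `Summit.ValiantsHypothesis.ValiantsHypothesis.…` is the tree's mandated single-conjunct layout
-- (Sub = Summit), so the duplicated namespace component is intended.
set_option linter.dupNamespace false

namespace Summit.ValiantsHypothesis.ValiantsHypothesis.Theorems

open Summit.ValiantsHypothesis.ValiantsHypothesis.Theses.MonotoneRestoration
open Literature.Computability.AlgebraicComplexity

/-- **TTRL-lite variant V21337 of `stub_symmetricMonotone`** (symmetry from transpositions).
If every transposition `swap i j` (`i ≠ j`) of the indices extends to an automorphism of the
labelled arithmetic circuit `C` (variables `x_ij`, diagonal `Sym_n`-action), then `C` is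
`Sym_n`-symmetric: the set of permutations admitting an extension contains `1`
(`isAutomorphismExtending_one`), is closed under products (`IsAutomorphismExtending.trans`), and
contains all transpositions, which generate `Sym_n` (`Equiv.Perm.swap_induction_on`).
[cite: DawarWilsenach2025, Defs. 3.6–3.7] -/
theorem stub_symmetricMonotone_var21337 :
    ∀ (n : ℕ) (G : Type) (C : LabelledArithCircuit NNReal (Fin n × Fin n) Unit G),
      (∀ i j : Fin n, i ≠ j → ∃ π : Equiv.Perm G, C.IsAutomorphismExtending (Equiv.swap i j) π) →
        C.IsSymmetric (Equiv.Perm (Fin n)) := by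
  intro n G C hswap ρ
  induction ρ using Equiv.Perm.swap_induction_on with
  | one => exact ⟨1, C.isAutomorphismExtending_one⟩
  | swap_mul f x y hxy ih =>
    obtain ⟨π, hπ⟩ := hswap x y hxy
    obtain ⟨π', hπ'⟩ := ih
    exact ⟨π * π', hπ'.trans hπ⟩

end Summit.ValiantsHypothesis.ValiantsHypothesis.Theorems
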